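import Literature.NumberTheory.QuadraticFields.ThreeTorsionMean
import Literature.NumberTheory.EllipticCurves.HeegnerPoints
import HarnessLib

/-!
# Davenport–Heilbronn with Heegner local conditions (Bhargava–Varma 2016, Cor. 4 (a)): named fact

Topic `NumberTheory/QuadraticFields`, continuing the Davenport–Heilbronn story of this directory
(`ThreeTorsionMean.lean`: carriers `negFundDiscrs X`, `quadFieldThreeTorsion D = #Cl₃(D)`, the
unconditioned mean `bst_threeTorsion_mean`; `ThreeTorsionMeanLocalAtThree.lean`: Cor. 4 (b) for REAL
fields with a local condition at `3`; `ThreeIndivisibleClassNumberLocalConditions.lean`: the EXISTENCE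
consequence of Cor. 4 (a) for split/inert conditions). This file types the IMAGINARY case of the same
corollary for the local conditions met in Heegner-point arguments.

M. Bhargava, I. Varma, *The mean number of 3-torsion elements in the class groups and ideal groups of
quadratic orders*, Proc. London Math. Soc. (3) 112 (2016) 235–266 = arXiv:1401.5875 (held corpus text
`paper:arxiv-1401.5875`; read: Cor. 4 p. 3–4 = chunk p0003 L133 – p0004 L5, and its proof §5.4 =
chunk p0021 L68–L80), **Corollary 4**, verbatim: "Suppose one restricts to just those quadratic fields
satisfying any specified set of local conditions at any finite set of primes. Then, when these quadratic
fields are ordered by their absolute discriminants: (a) The average number of `3`-torsion elements in the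
class groups of such imaginary quadratic fields is `2`. (b) The average number of `3`-torsion elements
in the class groups of such real quadratic fields is `4/3`." (Local conditions at `p` = a set `Σ_p` of
maximal orders in étale quadratic algebras over `ℚ_p`, p. 3: "for each prime `p`, let `Σ_p` be any set
of isomorphism classes of orders in étale quadratic algebras over `ℚ_p`"; Cor. 4 is the maximal-order
case of Thm. 3, proved in §5.4 by `M_Σ = 1`; no prime is exceptional — `2` and `3` included.)

* `bv_threeTorsion_mean_imaginary_heegnerOdd` — **Cor. 4 (a)** for the finite set of primes
  `{2} ∪ {ℓ : ℓ ∣ N}` (`N ≥ 1`) with the local specifications "`2` unramified" (`Σ_2 = {ℤ_2 ⊕ ℤ_2,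
  ℤ_2[ζ_3]}`, i.e. `d_K` odd) and "every prime `ℓ ∣ N` split" (`Σ_ℓ = {ℤ_ℓ ⊕ ℤ_ℓ}`; at `ℓ = 2`, if
  `2 ∣ N`, this refines the first condition), all maximal rings at every other prime: along `X ∈ ℕ`,
  the ratio `Σ #Cl₃(D) / Σ 1` over the negative fundamental discriminants `-X < D < 0`
  (`negFundDiscrs X`) that are odd and are the discriminant of an imaginary quadratic field `K` in which
  every prime factor of `N` splits tends to `2`. "Imaginary quadratic" and "split" are spelled in the
  tree's Heegner currency (`Literature.NumberTheory.EllipticCurves.IsImaginaryQuadratic`,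
  `SatisfiesHeegnerHypothesis N K`: two primes of `𝓞 K` above every prime `ℓ ∣ N`), exactly as in
  `IndivisibleClassNumberSplitPrimes.lean` / `ThreeIndivisibleClassNumberLocalConditions.lean`; the
  field `K` of discriminant `D` exists and is unique up to isomorphism (`Quadratic.isFundamental_iff_exists_discr_eq`,
  `Quadratic.nonempty_algEquiv_of_discr_eq`), so indexing the family by `D` is indexing it by fields.

Why it is wanted (crux `InertBadAtThree`, stmt-BirchSwinnertonDyer-19225, line `bed_at_three`, cell
bsd-wall row 12): it is the one printed input of the supply statement C⁺odd(N,3) «the odd Heegner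
discriminants of level `N` with `3 ∤ h` are not a `twistDensity`-null set», PROVED from this mean in
`Summits/BirchSwinnertonDyer/BirchSwinnertonDyer/Theorems/InertBadSignedBranchesInertBadAtThreeNonNullOddHeegner.lean`
(the family contains the progression `D ≡ 1 (mod 8N)`, of positive density by the tree's squarefree
count in progressions; `#Cl₃ ∈ {1} ∪ 3ℕ` and mean `2` give `3 ∤ h` on at least a quarter of it). The
analogue at a prime `p ≥ 5` (Cohen–Lenstra-type non-nullity of `p ∤ h` in a Heegner family) is NOT in
print; at `p = 3` it is this corollary.

-- TODO(general form): the printed statement covers every acceptable collection `(Σ_p)` of local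
-- specifications of maximal orders (and Thm. 3 every acceptable collection of orders, with mean
-- `1 + M_Σ`); only the Heegner instance "2 unramified, prime factors of `N` split" is typed here.

## Mathlib / tree search
Mathlib (pin v4.32.0): no Davenport–Heilbronn theory (searched `Davenport`, `Heilbronn`, `cubic form`,
`torsion classGroup`). Tree: `bst_threeTorsion_mean` (no local condition), `tt_threeTorsion_sum_progression`
/ `tt_twisted_threeTorsion_sum_neg` (Taniguchi–Thorne: progressions `a (mod m)` with `(6a, m) = 1`
only — cannot impose "3 split", needed when `3 ∣ N`), `bv_threeTorsion_mean_localAtThree` (real fields),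
`bhargavaVarma2016_exists_imaginaryQuadratic_split_inert_three_not_dvd_classNumber` (existence only, no
density), `BeckwithRaumRichter2024.thm1_…` (existence, odd primes). None gives a mean / density for an
imaginary family with a condition at `3`.

## References
* [BhargavaVarma2016] M. Bhargava, I. Varma, Proc. LMS (3) 112 (2016) 235–266, doi:10.1112/plms/pdv062
  = arXiv:1401.5875: Cor. 4 (a) (p. 237; arXiv p. 3–4), Thm. 3, §5.4 (proof of Cor. 4, Lemmas 37–38).
* H. Davenport, H. Heilbronn, Proc. Roy. Soc. London A 322 (1971) 405–420, Thm. 3 (the case of no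
  local conditions) [DavenportHeilbronn1971].
* J. Nakagawa, K. Horie, *Elliptic curves with no rational points*, Proc. AMS 104 (1988) 20–24
  (Davenport–Heilbronn with congruence conditions; cited for context, not typed).
-/

noncomputable section

open scoped Classical
open Finset Filter
open scoped Topology
open Literature.NumberTheory.EllipticCurves

namespace Literature.NumberTheory.QuadraticFields

/-- **Bhargava–Varma 2016, Corollary 4 (a), Heegner local conditions** (as printed: "Suppose one
restricts to just those quadratic fields satisfying any specified set of local conditions at any finite
set of primes. Then, when these quadratic fields are ordered by their absolute discriminants: (a) The
average number of `3`-torsion elements in the class groups of such imaginary quadratic fields is `2`."),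
for the local conditions at the finite set `{2} ∪ {ℓ prime : ℓ ∣ N}` (`N ≠ 0`): `2` unramified (`D` odd)
and every prime factor of `N` split. Along `X ∈ ℕ`: `Σ_{D} #Cl₃(D) / #{D} → 2`, `D` over the negative
fundamental discriminants `-X < D < 0` (`negFundDiscrs X`) that are odd and are the discriminant of an
imaginary quadratic `K` satisfying the Heegner hypothesis for `N`; `#Cl₃(D) = quadFieldThreeTorsion D`.
The family is infinite (it contains every squarefree `D < 0` with `D ≡ 1 (mod 8N)`:
`…Theorems.InertBadSignedBranchesInertBadAtThreeNonNullOddHeegner.card_progression_le_card_heegnerOddFamily`),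
so the ratio is not eventually the junk value `0/0`. Cite-only named fact; users take
`(h : bv_threeTorsion_mean_imaginary_heegnerOdd)`.
[cite: BhargavaVarma2016, Cor. 4 (a) (p. 237; arXiv:1401.5875 p. 3–4, proof §5.4)] -/
def bv_threeTorsion_mean_imaginary_heegnerOdd : Prop :=
  ∀ (N : ℕ), N ≠ 0 → Tendsto (fun X : ℕ =>
      (∑ D ∈ (negFundDiscrs X).filter (fun D => Odd D ∧ ∃ (K : Type) (_ : Field K) (_ : NumberField K),
          IsImaginaryQuadratic K ∧ NumberField.discr K = D ∧ SatisfiesHeegnerHypothesis N K),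
          (quadFieldThreeTorsion D : ℝ)) /
        (((negFundDiscrs X).filter (fun D => Odd D ∧ ∃ (K : Type) (_ : Field K) (_ : NumberField K),
          IsImaginaryQuadratic K ∧ NumberField.discr K = D ∧ SatisfiesHeegnerHypothesis N K)).card : ℝ))
    atTop (𝓝 2)

end Literature.NumberTheory.QuadraticFields

end
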